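import Summits.BirchSwinnertonDyer.BirchSwinnertonDyer.Theorems.InertBadSignedBranchesNoFiniteSubmoduleOfTower
import Summits.BirchSwinnertonDyer.BirchSwinnertonDyer.Theorems.InertBadSignedBranchesSignedReadingFactsOfParts
import Summits.BirchSwinnertonDyer.BirchSwinnertonDyer.Theorems.InertBadSignedBranchesLeafBridgeEtaK
import HarnessLib

/-!
# Route `InertBadSignedBranches` (rung K8, rev 11) — the support item `SignedReadingFacts`
# (stmt-BirchSwinnertonDyer-19502) FED BY PRINTED-SHAPE FACTS ONLY

Planner bsd-cm-plan g17 idle-menu M2 («K8 hygiene after p432273»), hand bsd-cm-k8i-c2 g5.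

`SignedReadingFacts` (19502) is the conjunction of two NAMED Literature facts read on the
`η`-component: Kitajima–Otsuki 2018 Main Thm. 1.3 at `η`
(`KitajimaOtsuki2018.mainThm13_etaSignedSelmerDual_noFiniteSubmodule`, reading flag `KO18-eta-summand`:
the printed theorem is about the WHOLE signed dual `X^ε(E/K_∞)`, the `η`-part being a direct summand) and
Kobayashi 2003 Thm. 7.4 (ii) ⟺ (iii) at `η` (`Kobayashi2003.thm74_etaEvenMC_iff_etaOddMC`). Hand k8i-ty g3 /
k7r-c4 g3 landed (p432273, `Theorems/InertBadSignedBranchesNoFiniteSubmoduleOfTower.lean`) the kernel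
descent `TowerReadingsOfLiterature.mainThm13_eta_of_tower`: the `η`-fact is a THEOREM from the two
PRINTED-SHAPE whole-tower facts `KitajimaOtsuki2018.mainThm13_towerSignedSelmerDual_noFiniteSubmodule`
(Main Thm. 1.3 = Thm. 4.8 verbatim, `F = F′ = ℚ`) and `Kobayashi2003.thm22_towerSignedSelmerDual_finite_torsion`
(Thm. 2.2 verbatim), through bsd-potss's construction of the whole dual datum and its `η`-descent
`Additive.EtaSignedSelmerDualData.forall_finite_eq_bot_of_tower`. This file composes that descent with the
closed glue item `SignedReadingFactsOfParts` (19520, p432960) so that the route's support item — and hence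
the binder `hR` of the deciding theorem `closes` — is fed by printed-shape facts only:

* §1 `signedReadingFacts_of_tower : KO18 Main Thm 1.3 (whole tower) → Kob03 Thm 2.2 (whole tower) →
  Kob03 Thm 7.4 at η → SignedReadingFacts` (M2 verbatim), with the by-name part
  `publishedInputKO13_of_tower` (item 19301's Prop as a theorem from the two printed-shape facts);
* §2 the aside `NoFiniteSubmoduleMinus` (19233: (R2⁻) for every `W`, `p ≥ 5`) BY NAME from the same two
  printed-shape facts (`noFiniteSubmoduleMinus_of_tower`, via p432273 §3);
* §3 the rung leaf `X12.CMInertBad` from the route's cruxes / residuals / `PlusMCEtaK` /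
  `PublishedFactsInert` with `hR` replaced by the three printed-shape facts
  (`cmInertBad_of_cruxes_of_towerFacts` = `closes` ∘ §1 ∘ the closed glue `LeafBridgeEtaK` 19503).

HONEST LABEL: compositions of landed theorems; every statement displays its fact hypotheses (cite-tagged
Literature `Prop`s taken as `(h : X)`, i.e. CONDITIONAL); nothing about BSD, C-cc-1 (19223) or (C1_η)/`PlusMCEtaK`
(19501) is asserted; no item is closed by this file (it rides `--supports stmt-BirchSwinnertonDyer-19502`);
no new `def`, no named fact minted, no `sorry`. What it changes: at ITEM level the reading flag
`KO18-eta-summand` is retired — 19502 now follows from Main Thm. 1.3 / Thm. 2.2 / Thm. 7.4 in their printed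
shape. [cite: KitajimaOtsuki2018, Main Thm. 1.3 (= Thm. 4.8) and Remark 1.4 (5) (arXiv:1607.03612 pp. 3–4)]
[cite: Kobayashi2003, Thm. 2.2 (p. 5), §4 (p. 8), Thm. 7.4 (p. 13)]
-/

set_option linter.dupNamespace false

namespace Summit.BirchSwinnertonDyer.BirchSwinnertonDyer.Theorems.SignedReadingFactsOfTower

open Summit.BirchSwinnertonDyer.BirchSwinnertonDyer.Theses.InertBadSignedBranches
open Literature.NumberTheory.EllipticCurves

/-! ## §1 `SignedReadingFacts` (19502) from the printed-shape tower facts -/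

/-- **Item 19301's Prop `PublishedInputKO13` (= Kitajima–Otsuki Main Thm. 1.3 read at `η`) as a THEOREM
from the two printed-shape whole-tower facts** — hand k8i-ty/k7r-c4's `TowerReadingsOfLiterature.mainThm13_eta_of_tower`
(p432273) restated on the route's by-name child. CONDITIONAL on the displayed facts.
[cite: KitajimaOtsuki2018, Main Thm. 1.3 (= Thm. 4.8) and Remark 1.4 (5) (arXiv:1607.03612 pp. 3–4)]
[cite: Kobayashi2003, Thm. 2.2 (p. 5)] -/
theorem publishedInputKO13_of_tower
    (h13 : KitajimaOtsuki2018.mainThm13_towerSignedSelmerDual_noFiniteSubmodule)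
    (h22 : Kobayashi2003.thm22_towerSignedSelmerDual_finite_torsion) :
    PublishedInputKO13 :=
  TowerReadingsOfLiterature.mainThm13_eta_of_tower h13 h22

/-- **M2 (planner bsd-cm-plan g17): `SignedReadingFacts` (stmt-BirchSwinnertonDyer-19502) from PRINTED-SHAPE
facts only** — Kitajima–Otsuki 2018 Main Thm. 1.3 for the whole signed dual over the cyclotomic tower
(`F = F′ = ℚ`), Kobayashi 2003 Thm. 2.2 for the whole dual, and Kobayashi 2003 Thm. 7.4 (ii) ⟺ (iii) at `η`:
the `η`-descent `TowerReadingsOfLiterature.mainThm13_eta_of_tower` (p432273) composed with the closed glue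
item `SignedReadingFactsOfParts` (19520, `inertBadSignedBranches_signedReadingFactsOfParts_proof`, p432960).
CONDITIONAL on the three displayed named facts; the reading flag `KO18-eta-summand` no longer enters 19502.
[cite: KitajimaOtsuki2018, Main Thm. 1.3 (= Thm. 4.8) and Remark 1.4 (5) (arXiv:1607.03612 pp. 3–4)]
[cite: Kobayashi2003, Thm. 2.2 (p. 5), Thm. 7.4 (p. 13)] -/
theorem signedReadingFacts_of_tower
    (h13 : KitajimaOtsuki2018.mainThm13_towerSignedSelmerDual_noFiniteSubmodule)
    (h22 : Kobayashi2003.thm22_towerSignedSelmerDual_finite_torsion)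
    (h74 : Kobayashi2003.thm74_etaEvenMC_iff_etaOddMC) :
    SignedReadingFacts :=
  inertBadSignedBranches_signedReadingFactsOfParts_proof
    (TowerReadingsOfLiterature.mainThm13_eta_of_tower h13 h22) h74

/-! ## §2 The aside `NoFiniteSubmoduleMinus` (19233) by name, from the same printed-shape facts -/

/-- **(R2⁻) on every `(W, p)`, `p ≥ 5` — the aside item `NoFiniteSubmoduleMinus` (stmt-BirchSwinnertonDyer-19233)
BY NAME — from Kitajima–Otsuki Main Thm. 1.3 and Kobayashi Thm. 2.2 in their printed (whole-tower) shape**: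
p432273 §3 `TowerReadingsOfLiterature.oddBranchStrictMinusNoFiniteSubmoduleAt_of_tower` (x1b's P5-5b
dictionary fed with the `η`-descent), universally closed over the aside's binders (the guard `5 ≤ p` is not
used). CONDITIONAL on the two displayed facts; the aside stays an item of record (nothing closed here).
[cite: KitajimaOtsuki2018, Main Thm. 1.3 (= Thm. 4.8) with Def. 2.1 (arXiv:1607.03612 pp. 3, 6)]
[cite: Kobayashi2003, Thm. 2.2 (p. 5)] -/
theorem noFiniteSubmoduleMinus_of_tower
    (h13 : KitajimaOtsuki2018.mainThm13_towerSignedSelmerDual_noFiniteSubmodule)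
    (h22 : Kobayashi2003.thm22_towerSignedSelmerDual_finite_torsion) :
    NoFiniteSubmoduleMinus :=
  fun W _ _ p _ _hp =>
    TowerReadingsOfLiterature.oddBranchStrictMinusNoFiniteSubmoduleAt_of_tower W p h13 h22

/-! ## §3 The rung leaf with `hR` fed by the printed-shape facts -/

/-- **The rung leaf `X12.CMInertBad` from the route's cruxes `CccOneLawOnTypeIstarZero` (19223, C-cc-1 on
the type, OPEN) and `PlusMCEtaK` (19501, imported conjecture-grade input), the residuals `InertBadOffType`
(19224) / `InertBadAtThree` (19225), the published facts `PublishedFactsInert` (19227), and — in place of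
`SignedReadingFacts` — the three PRINTED-SHAPE facts KO18 Main Thm. 1.3 (whole tower), Kob03 Thm. 2.2 (whole
tower), Kob03 Thm. 7.4 at `η`**: the route's deciding theorem `closes` with `hR := signedReadingFacts_of_tower
h13 h22 h74` and the closed glue `LeafBridgeEtaK` (19503, p432060). CONDITIONAL on every displayed
hypothesis — an implication; BSD is not claimed, 19223 / 19501 / the residuals stay OPEN.
[cite: Kobayashi2003, Thm. 2.2 (p. 5), §4 (p. 8), Thm. 7.4 (p. 13)]
[cite: KitajimaOtsuki2018, Main Thm. 1.3 (= Thm. 4.8) (arXiv:1607.03612 p. 3)] -/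
theorem cmInertBad_of_cruxes_of_towerFacts
    (h₁ : CccOneLawOnTypeIstarZero) (h₂ : InertBadOffType) (h₃ : InertBadAtThree) (hK : PlusMCEtaK)
    (h13 : KitajimaOtsuki2018.mainThm13_towerSignedSelmerDual_noFiniteSubmodule)
    (h22 : Kobayashi2003.thm22_towerSignedSelmerDual_finite_torsion)
    (h74 : Kobayashi2003.thm74_etaEvenMC_iff_etaOddMC)
    (h₆ : PublishedFactsInert) :
    Summit.BirchSwinnertonDyer.Rank1Residual.X12.CMInertBad :=
  closes h₁ h₂ h₃ hK (signedReadingFacts_of_tower h13 h22 h74) h₆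
    inertBadSignedBranches_leafBridgeEtaK_proof

end Summit.BirchSwinnertonDyer.BirchSwinnertonDyer.Theorems.SignedReadingFactsOfTower
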